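import Literature.Analysis.FluidPDE.FluidComputer.SpaceGroupSymmetry
import HarnessLib

/-!
# Sublattice support of a `z`-periodic datum persists: low shells hold only `z`-mean modes

HONEST FRAMING (cell `pub-fluidc`, verbatim): *low prior, high value-of-information experiment on Tao's
machine paradigm; NOT a claim that NS blows up.* Nothing here concerns the Navier–Stokes PDE beyond the
Galerkin-truncated ODE system both engines of the cell integrate
(`Literature.Analysis.FluidPDE.FluidComputer.ShellTransfer.IsGalerkinSolution`).

This file types the EXACT part of the cell's "low-shell / symmetry-subspace certificate" for data that are
periodic in `z` with period `2π/m` (GADGETS gen 43, STATUS 2026-08-20T08:05Z, record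
`code/gadgets/tests/houluo_lowshell_cert_j091074.md`; STRIP A17 (1) / A17a): the pure-swirl Hou–Luo-type
gadget data at wavelength `λ = L/m` live on `k_z ∈ mℤ`, and the claim is that this stays so for all times,
so that every shell `|k| < m` can only hold `z`-MEAN modes (`k_z = 0`). As mathematics this is folklore
(a lattice translation commutes with the truncated dynamics; uniqueness), and every ingredient is already
in the tree (`ShellTransfer.translate_eq_self`, `ShellTransfer.vertical`, `ShellTransfer.phase`); what is
added here is the arithmetic of the phase at one period and the packaging the seats can cite:

* `coeff_eq_zero_of_phase_ne_one` — a field fixed by the translation by `a` vanishes at every wavevector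
  whose phase `e^{-ik·a}` is not `1`;
* `phase_period_eq_one_iff` — for the vertical translation `ShellTransfer.vertical (2π/m)` (`m ≥ 1`) the phase at
  `k` equals `1` iff `m ∣ k₂`;
* `coeff_eq_zero_of_periodic` — SUBLATTICE SUPPORT: a field fixed by that translation vanishes off
  `{k : m ∣ k₂}`;
* `coeff_eq_zero_persists`, `modalEnergy_eq_zero_persists` — along every UNFORCED Galerkin solution
  (any viscosity `ν`, any pressure multiplier, ANY mode set `S` in which the solution is supported — masks
  are not moved by translations) whose datum at one time is fixed by the vertical translation by `2π/m`,
  every coefficient with `m ∤ k₂` vanishes at every time, and so does its modal energy;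
* `apply_two_eq_zero_of_low_shell` — a wavevector with `|k|² < m²` and `m ∣ k₂` has `k₂ = 0`;
* `low_shell_offplane_empty` — COROLLARY (the exact content of GADGETS C1/C3 and STRIP A17 (1) for the
  `eps_pol = 0` members, for every run on every mask): along such a solution every mode with `|k|² < m²`
  and `k₂ ≠ 0` is empty at all times. What is NOT claimed: that the `z`-mean plane itself is empty (that
  part of the seats' argument uses axisymmetry, which the Cartesian truncation has only as a `D₄`), or
  anything about round-off (the typed statement is about exact solutions of the truncated system).

0 sorry, 0 named facts (D-0026). [folklore]
-/

noncomputable section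

namespace Summit.NavierStokesRegularity.FluidComputer.SublatticeSupport

open Literature.Analysis.FluidPDE.FluidComputer
open Literature.Analysis.FluidPDE.FluidComputer.ShellTransfer
open Complex

/-- A field fixed by the translation by `a` vanishes at every wavevector whose phase `e^{-ik·a}` is not
`1` (generalises `ShellTransfer.coeff_eq_zero_of_translate_eq_self`, the phase `-1` case). [folklore] -/
theorem coeff_eq_zero_of_phase_ne_one {A : FourierVelocity} {a : Fin 3 → ℝ} (h : translate a A = A)
    {k : Fin 3 → ℤ} (hk : phase a k ≠ 1) : A.coeff k = 0 := by
  funext j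
  have hc := congrArg (fun B : FourierVelocity => B.coeff k j) h
  simp only [translate_coeff] at hc
  have h2 : (phase a k - 1) * A.coeff k j = 0 := by linear_combination hc
  rcases mul_eq_zero.mp h2 with h3 | h3
  · exact absurd (sub_eq_zero.mp h3) hk
  · simpa using h3

/-- The phase of the vertical translation by one period `2π/m` (`ShellTransfer.vertical (2π/m)`) at `k`
is `exp(-2πi k₂/m)`. [folklore] -/
theorem phase_period (m : ℕ) (k : Fin 3 → ℤ) :
    phase (vertical (2 * Real.pi / m)) k
      = Complex.exp ((((-(((k 2 : ℤ) : ℝ) * (2 * Real.pi / m)) : ℝ)) : ℂ) * I) := by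
  unfold phase
  rw [rdot_vertical]

/-- **The phase of the one-period vertical translation at `k` is `1` iff `m ∣ k₂`** (`m ≥ 1`). [folklore] -/
theorem phase_period_eq_one_iff {m : ℕ} (hm : m ≠ 0) (k : Fin 3 → ℤ) :
    phase (vertical (2 * Real.pi / m)) k = 1 ↔ (m : ℤ) ∣ k 2 := by
  have hmR : (m : ℝ) ≠ 0 := by exact_mod_cast hm
  have hr : (2 * Real.pi / m) ≠ 0 := div_ne_zero (by positivity) hmR
  rw [phase_period, Complex.exp_eq_one_iff]
  constructor
  · rintro ⟨n, hn⟩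
    -- cancel the common factor `I` and come back to the reals
    have hn' : (((-(((k 2 : ℤ) : ℝ) * (2 * Real.pi / m))) : ℝ) : ℂ) * I
        = ((((n : ℝ) * (2 * Real.pi)) : ℝ) : ℂ) * I := by
      rw [hn]; push_cast; ring
    have hreal : -(((k 2 : ℤ) : ℝ) * (2 * Real.pi / m)) = (n : ℝ) * (2 * Real.pi) := by
      exact_mod_cast mul_right_cancel₀ Complex.I_ne_zero hn'
    have e : ((n : ℝ) * m) * (2 * Real.pi / m) = (n : ℝ) * (2 * Real.pi) := by
      field_simp
    have hk : ((k 2 : ℤ) : ℝ) = -((n : ℝ) * m) := by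
      have h0 : (((k 2 : ℤ) : ℝ) + (n : ℝ) * m) * (2 * Real.pi / m) = 0 := by
        calc (((k 2 : ℤ) : ℝ) + (n : ℝ) * m) * (2 * Real.pi / m)
            = ((k 2 : ℤ) : ℝ) * (2 * Real.pi / m) + ((n : ℝ) * m) * (2 * Real.pi / m) := by ring
          _ = 0 := by rw [e]; linarith [hreal]
      have := (mul_eq_zero.mp h0).resolve_right hr
      linarith
    have hkZ : k 2 = -n * m := by
      have : ((k 2 : ℤ) : ℝ) = (((-n * m : ℤ)) : ℝ) := by rw [hk]; push_cast; ring
      exact_mod_cast this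
    exact ⟨-n, by rw [hkZ]; ring⟩
  · rintro ⟨q, hq⟩
    refine ⟨-q, ?_⟩
    have e : -((((m : ℤ) * q : ℤ) : ℝ) * (2 * Real.pi / m)) = ((-q : ℤ) : ℝ) * (2 * Real.pi) := by
      push_cast
      field_simp
    rw [hq, e]
    push_cast
    ring

/-- **SUBLATTICE SUPPORT**: a field fixed by the vertical translation by one period `2π/m` (`m ≥ 1`)
vanishes at every wavevector with `m ∤ k₂`. [folklore] -/
theorem coeff_eq_zero_of_periodic {A : FourierVelocity} {m : ℕ} (hm : m ≠ 0)
    (h : translate (vertical (2 * Real.pi / m)) A = A) {k : Fin 3 → ℤ} (hk : ¬ (m : ℤ) ∣ k 2) : A.coeff k = 0 :=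
  coeff_eq_zero_of_phase_ne_one h fun h1 => hk ((phase_period_eq_one_iff hm k).mp h1)

/-- Conversely, a field supported on `{k : m ∣ k₂}` is fixed by that translation. [folklore] -/
theorem translate_period_eq_self_of_support {A : FourierVelocity} {m : ℕ} (hm : m ≠ 0)
    (h : ∀ k : Fin 3 → ℤ, ¬ (m : ℤ) ∣ k 2 → A.coeff k = 0) : translate (vertical (2 * Real.pi / m)) A = A := by
  refine TaylorGreenHat.fourierVelocity_ext ?_
  funext k j
  rw [translate_coeff]
  by_cases hk : (m : ℤ) ∣ k 2
  · rw [(phase_period_eq_one_iff hm k).mpr hk, one_mul]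
  · rw [h k hk]
    simp

/-- **PERSISTENCE OF SUBLATTICE SUPPORT.** Along every unforced Galerkin solution (any `ν`, any pressure
multiplier, any mode set `S` carrying the solution) whose datum at one time `t₀` is fixed by the vertical
translation by `2π/m`, every coefficient with `m ∤ k₂` vanishes at every time. [folklore] -/
theorem coeff_eq_zero_persists {U : ℝ → FourierVelocity} {S : Finset (Fin 3 → ℤ)} {ν : ℝ}
    {c : ℝ → (Fin 3 → ℤ) → ℂ} (hU : IsGalerkinSolution U S ν c fun _ _ _ => 0)
    (hs : IsSupportedOn U S) {m : ℕ} (hm : m ≠ 0) {t₀ : ℝ}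
    (h0 : translate (vertical (2 * Real.pi / m)) (U t₀) = U t₀) (t : ℝ) {k : Fin 3 → ℤ} (hk : ¬ (m : ℤ) ∣ k 2) :
    (U t).coeff k = 0 :=
  coeff_eq_zero_of_periodic hm (translate_eq_self hU hs (vertical (2 * Real.pi / m)) h0 t) hk

/-- … and so does its modal energy. [folklore] -/
theorem modalEnergy_eq_zero_persists {U : ℝ → FourierVelocity} {S : Finset (Fin 3 → ℤ)} {ν : ℝ}
    {c : ℝ → (Fin 3 → ℤ) → ℂ} (hU : IsGalerkinSolution U S ν c fun _ _ _ => 0)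
    (hs : IsSupportedOn U S) {m : ℕ} (hm : m ≠ 0) {t₀ : ℝ}
    (h0 : translate (vertical (2 * Real.pi / m)) (U t₀) = U t₀) (t : ℝ) {k : Fin 3 → ℤ} (hk : ¬ (m : ℤ) ∣ k 2) :
    modalEnergy (U t) k = 0 :=
  modalEnergy_eq_zero_of_coeff _ (coeff_eq_zero_persists hU hs hm h0 t hk)

/-- The symmetry itself persists (restated for citation). [folklore] -/
theorem translate_period_persists {U : ℝ → FourierVelocity} {S : Finset (Fin 3 → ℤ)} {ν : ℝ}
    {c : ℝ → (Fin 3 → ℤ) → ℂ} (hU : IsGalerkinSolution U S ν c fun _ _ _ => 0)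
    (hs : IsSupportedOn U S) (m : ℕ) {t₀ : ℝ} (h0 : translate (vertical (2 * Real.pi / m)) (U t₀) = U t₀) (t : ℝ) :
    translate (vertical (2 * Real.pi / m)) (U t) = U t :=
  translate_eq_self hU hs (vertical (2 * Real.pi / m)) h0 t

/-- **LOW SHELLS HOLD ONLY `z`-MEAN SUBLATTICE POINTS**: `|k|² < m²` and `m ∣ k₂` force `k₂ = 0`.
[folklore] -/
theorem apply_two_eq_zero_of_low_shell {m : ℕ} {k : Fin 3 → ℤ} (hlow : knormSq k < (m : ℝ) ^ 2)
    (hdiv : (m : ℤ) ∣ k 2) : k 2 = 0 := by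
  by_contra hne
  obtain ⟨q, hq⟩ := hdiv
  have hq0 : q ≠ 0 := by
    rintro rfl
    exact hne (by simpa using hq)
  have hq1 : (1 : ℤ) ≤ q ^ 2 := by
    have : 0 < q ^ 2 := by positivity
    linarith
  have hsq : ((m : ℤ) : ℝ) ^ 2 ≤ ((k 2 : ℤ) : ℝ) ^ 2 := by
    have hz : (m : ℤ) ^ 2 ≤ (k 2) ^ 2 := by
      rw [hq]
      nlinarith [sq_nonneg (m : ℤ)]
    exact_mod_cast hz
  have hle : ((k 2 : ℤ) : ℝ) ^ 2 ≤ knormSq k := by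
    unfold knormSq
    rw [Fin.sum_univ_three]
    nlinarith [sq_nonneg ((k 0 : ℤ) : ℝ), sq_nonneg ((k 1 : ℤ) : ℝ)]
  have hm : ((m : ℤ) : ℝ) = (m : ℝ) := by push_cast; ring
  rw [hm] at hsq
  linarith

/-- **COROLLARY (the exact content of the cell's low-shell certificate).** Along every unforced Galerkin
solution, on any mask, whose datum is fixed by the vertical translation by `2π/m` (`m ≥ 1`), every mode
in the open ball `|k|² < m²` with `k₂ ≠ 0` is empty at every time, coefficient and energy. [folklore] -/
theorem low_shell_offplane_empty {U : ℝ → FourierVelocity} {S : Finset (Fin 3 → ℤ)} {ν : ℝ}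
    {c : ℝ → (Fin 3 → ℤ) → ℂ} (hU : IsGalerkinSolution U S ν c fun _ _ _ => 0)
    (hs : IsSupportedOn U S) {m : ℕ} (hm : m ≠ 0) {t₀ : ℝ}
    (h0 : translate (vertical (2 * Real.pi / m)) (U t₀) = U t₀) (t : ℝ) {k : Fin 3 → ℤ}
    (hlow : knormSq k < (m : ℝ) ^ 2) (hk2 : k 2 ≠ 0) :
    (U t).coeff k = 0 ∧ modalEnergy (U t) k = 0 := by
  have hk : ¬ (m : ℤ) ∣ k 2 := fun hdiv => hk2 (apply_two_eq_zero_of_low_shell hlow hdiv)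
  exact ⟨coeff_eq_zero_persists hU hs hm h0 t hk, modalEnergy_eq_zero_persists hU hs hm h0 t hk⟩

end Summit.NavierStokesRegularity.FluidComputer.SublatticeSupport

end
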